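import Summits.Ventures.HSemireg.UntwistCocycleTwistHom
import Summits.Ventures.HSemireg.UntwistCocycleTwistSigma
import HarnessLib

/-!
# Venture HSemireg — route R1.0, untwisted reading: the form-degree-`0` row of the Leibniz re-expansion `hσ`
# DISCHARGED on real carriers — `Tr_{E ⊗ M}(x ⊗ 1_M) = Tr_E(x)`, so `0`-semiregularity of `E` iff of `E ⊗ M`
# UNCONDITIONALLY (th-4 file #17; sequel of #13 and #16)

HONEST FRAMING. Module-level homological algebra on the tree's REAL carriers (Mathlib's `Abelian.Ext` in `X.Modules`,
the trace `traceExt`, `σ_0 = sigmaZero`, `sigmaHigher _ 0` of `HodgeTheory/AtiyahClassTraceReal.lean` /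
`SemiregularityHigherSigma.lean`) for the CONSTRUCTED cocycle twist `- ⊗ M` (`M = lineBundle c`, files #11/#12).
Nothing about any variety; no gerbe; nothing here says HC, HC_CM or HC_AV is proved.

WHAT CHANGES. In `UntwistCocycleTwistSigma.lean` (#13) the transport `IsISemiregular(E) ↔ IsISemiregular(E ⊗ M)`
holds GIVEN the triangular re-expansion
`hσ : σ_q^{E ⊗ M}(θ x) = σ_q^{E}(x) + Σ_{j<q} u_{q,j}(σ_j^{E} x)` for `q ∈ I` (the Leibniz rule
`At(E ⊗ M) = At(E) ⊗ 1 + 1 ⊗ At(M)`, Atiyah 1957 Prop. 10–12 — «STILL A BINDER: the tree has no Leibniz rule on real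
carriers»; red-1 V18-U2: «hσ discharged for NO `I ≠ ∅`»). This file PROVES the row `q = 0` of `hσ`, for EVERY cocycle
`c` and every finite locally free `E`, with `u = 0`, `d_0 = id`:

* `mapExactFunctor_comp_mk₀_eq` — Mathlib's `Ext.mapExactFunctor` is natural along any natural comparison
  `γ_Y : H(Y) → H'(Φ Y)` of exact functors (source with enough injectives; dimension shifting), and its «sandwich» form
  `mk₀_comp_mapExactFunctor_comp_mk₀_eq` (`u' ≫ H'(Φ x) ≫ tr' = u ≫ H(x) ≫ tr` once `u ≫ γ_E = u'`, `γ_E ≫ tr' = tr`);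
* `traceExt_twist` — **`Tr_{E ⊗ M}(x ⊗ 1_M) = Tr_E(x)` in `Extⁿ(𝒪_X, 𝒪_X)`** for all `n` and all `x ∈ Extⁿ(E, E)`
  (`x ⊗ 1_M := (twistEquivalence X c).functor.mapExtAddHom E E n x`, the constructed `θ`): `Tr = u ≫ 𝓗om(E, –) ≫ tr`
  (`traceExt_apply`), the comparison `γ = sheafHomTwist` of file #16 intertwines `𝓗om(E, –)` with
  `𝓗om(E ⊗ M, –) ∘ (- ⊗ M)` and preserves unit and trace;
* `sigmaZero_twist`, `sigmaHigher_zero_twist` — **`σ_0^{E ⊗ M}(θ x) = σ_0^{E}(x)`** on both carriers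
  (`H²(X, 𝒪_X)` and `H²(X, Ω⁰)`): the `q = 0` instance of `hσ`;
* `isZeroSemiregular_iff_twist`, `isHigherSemiregular_zero_iff_twist` — **`0`-semiregularity (injectivity of the
  Mukai–Artamkin trace `σ_0 : Ext²(E, E) → H²(X, 𝒪_X)`) of `E` iff of `E ⊗ M`**, NO binder;
* `isISemiregular_Iic_zero_iff_twist` — file #13's `isISemiregular_iff_twist` at `I = {0} = Iic 0` with its hypothesis
  `hσ` DISCHARGED (so #13 §2 is non-vacuous with `I ≠ ∅` at every cocycle `c`, not only at `c = 1`);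
* (v1.1) `isISemiregular_iff_twist_of_pos` — the binder `hσ` is now asked only in form degrees `q ≥ 1`;
  `isISemiregular_Iic_one_iff_twist_of_sigmaOne` — `{0,1}`-semiregularity transports given ONLY the degree-one identity
  `σ_1^{E ⊗ M}(θ x) = σ_1^{E}(x) + u(σ_0^{E} x)`; `mk₀_comp_mapExactFunctor_comp_mk₀_eq'` — the sandwich form with
  coefficients (`x ∈ Extⁿ(E, Y)`), for the trace `Tr_G` of the rows `q ≥ 1`.

What stays declared (route R1.0, untwisted reading): the rows `q ≥ 1` of `hσ` (they involve `At(M) = [dlog g_{xy}]` and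
cup products on `H^•(X, Ω^•)`: the Leibniz rule proper), and everything on the gerbe side (odd `m`). Which Ext groups:
`Ext²_{𝒪_{X₀}}(E₀, E₀)` (by value `18` at the `g = 4` anchor) and its image in `H²(X₀, 𝒪)` (the `h^{0,2} = C(4,2) = 6`
-dimensional block of the `28`-dimensional target `⊕_q H^{q+2}(Ω^q)`, `28 = 6 + 16 + 6`); which class: `tr` (the rank /
`ch_0` component of `σ`); which twist: `- ⊗ M_B`, `M_B = lineBundle c` (file #15).

## References

* R.-O. Buchweitz, H. Flenner, *A semiregularity map for modules and applications to deformations*, Compositio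
  Math. 137 (2003), §1 (`σ_0`), Def. 4.1, §4 (trace maps), §5 (`I`-semiregular). [BuchweitzFlenner2003]
* M. F. Atiyah, *Complex analytic connections in fibre bundles*, Trans. AMS 85 (1957), Prop. 10–12 (the rows
  `q ≥ 1`, not used here). [Atiyah1957]
* R. Hartshorne, *Algebraic Geometry* (1977), III.2.2 (enough injectives in `Mod(𝒪_X)`), III.6.3. [Hartshorne1977]
-/

noncomputable section

open CategoryTheory CategoryTheory.Abelian CategoryTheory.Limits AlgebraicGeometry Opposite TopologicalSpace

namespace Summit.Ventures.HSemireg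

/-! ### `Ext.mapExactFunctor` is natural along a comparison `γ_Y : H(Y) → H'(Φ Y)` of exact functors -/

section ExtFunctoriality

universe w w' w'' v v' v'' u u' u''

variable {C : Type u} [Category.{v} C] [Abelian C] {D : Type u'} [Category.{v'} D] [Abelian D]
  {D' : Type u''} [Category.{v''} D'] [Abelian D']
  (Φ : C ⥤ D) (H : C ⥤ D') (H' : D ⥤ D') [Φ.Additive] [H.Additive] [H'.Additive]
  [PreservesFiniteLimits Φ] [PreservesFiniteColimits Φ] [PreservesFiniteLimits H] [PreservesFiniteColimits H]
  [PreservesFiniteLimits H'] [PreservesFiniteColimits H'] [HasExt.{w} C] [HasExt.{w'} D] [HasExt.{w''} D']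
  [EnoughInjectives C] (γ : ∀ Y : C, H.obj Y ⟶ H'.obj (Φ.obj Y))
  (hγ : ∀ ⦃Y Y' : C⦄ (f : Y ⟶ Y'), H.map f ≫ γ Y' = γ Y ≫ H'.map (Φ.map f))

include hγ in
/-- **`Ext.mapExactFunctor` is natural in the exact functor, along any natural comparison
`γ_Y : H(Y) → H'(Φ(Y))`** of exact additive functors (`H : C ⥤ D'`, `Φ : C ⥤ D`, `H' : D ⥤ D'`; source with enough
injectives): `H(x) ≫ γ_Y = γ_X ≫ H'(Φ(x))` in `Extⁿ(H X, H'(Φ Y))`. Dimension shifting: degree `0` is the naturality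
square `hγ`; a class of degree `n + 1` is `x₃ ≫ δ` for the connecting class `δ` of an injective presentation, and `δ`
is natural by Mathlib's `ShortExact.extClass_naturality` + `Ext.mapExactFunctor_extClass`. (The tree's
`Ext.mk₀_comp_mapExactFunctor_of_natIso` is the case `Φ = 𝟭` with `γ` an ISOMORPHISM and no enough-injectives
hypothesis; here `γ` is only a transformation — the case of `𝓗om(E, –) ⟶ 𝓗om(E ⊗ M, – ⊗ M)`.) [folklore] -/
theorem mapExactFunctor_comp_mk₀_eq {X Y : C} {n : ℕ} (x : Ext X Y n) :
    (x.mapExactFunctor H).comp (Ext.mk₀ (γ Y)) (add_zero n) =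
      (Ext.mk₀ (γ X)).comp ((x.mapExactFunctor Φ).mapExactFunctor H') (zero_add n) := by
  induction n generalizing Y with
  | zero =>
    obtain ⟨f, rfl⟩ := (Ext.mk₀_bijective X Y).2 x
    rw [Ext.mapExactFunctor_mk₀, Ext.mapExactFunctor_mk₀, Ext.mapExactFunctor_mk₀, Ext.mk₀_comp_mk₀,
      Ext.mk₀_comp_mk₀, hγ]
  | succ n ih =>
    let I : InjectivePresentation Y := (EnoughInjectives.presentation Y).some
    let S : ShortComplex C := ShortComplex.mk _ _ (cokernel.condition I.f)
    have hS : S.ShortExact := { exact := ShortComplex.exact_cokernel I.f }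
    haveI : Injective S.X₂ := I.injective
    obtain ⟨x₃, rfl⟩ : ∃ x₃ : Ext X S.X₃ n, x₃.comp hS.extClass rfl = x :=
      Ext.covariant_sequence_exact₁ X hS x (Ext.eq_zero_of_injective _) rfl
    -- the comparison `γ` on the three terms is a morphism of short exact sequences `H(S) → H'(Φ(S))`
    let τ : S.map H ⟶ (S.map Φ).map H' :=
      { τ₁ := γ S.X₁, τ₂ := γ S.X₂, τ₃ := γ S.X₃, comm₁₂ := (hγ S.f).symm, comm₂₃ := (hγ S.g).symm }
    have hτ := (hS.map_of_exact H).extClass_naturality ((hS.map_of_exact Φ).map_of_exact H') τ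
    have e1 : (hS.extClass).mapExactFunctor H = (hS.map_of_exact H).extClass := Ext.mapExactFunctor_extClass H hS
    have e2 : ((hS.extClass).mapExactFunctor Φ).mapExactFunctor H' = ((hS.map_of_exact Φ).map_of_exact H').extClass :=
      (congrArg (Ext.mapExactFunctor H') (Ext.mapExactFunctor_extClass Φ hS)).trans
        (Ext.mapExactFunctor_extClass H' (hS.map_of_exact Φ))
    have hnat : ((hS.extClass).mapExactFunctor H).comp (Ext.mk₀ (γ Y)) (add_zero 1) =
        (Ext.mk₀ (γ S.X₃)).comp (((hS.extClass).mapExactFunctor Φ).mapExactFunctor H') (zero_add 1) :=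
      ((congrArg (fun a => Ext.comp a (Ext.mk₀ (γ Y)) (add_zero 1)) e1).trans hτ).trans
        (congrArg (fun a => (Ext.mk₀ (γ S.X₃)).comp a (zero_add 1)) e2).symm
    rw [Ext.mapExactFunctor_comp, Ext.mapExactFunctor_comp, Ext.mapExactFunctor_comp,
      Ext.comp_assoc_of_third_deg_zero, hnat, ← Ext.comp_assoc_of_second_deg_zero, ih x₃]
    exact Ext.comp_assoc _ _ _ (zero_add n) rfl (by omega)

include hγ in
/-- **Sandwich form** (the shape of a trace map `Tr(x) = u ≫ H(x) ≫ tr`): if `u ≫ γ_E = u'` and `γ_E ≫ tr' = tr` then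
`u' ≫ H'(Φ(x)) ≫ tr' = u ≫ H(x) ≫ tr` in `Extⁿ(O, O')` for every `x ∈ Extⁿ(E, E)`. [folklore] -/
theorem mk₀_comp_mapExactFunctor_comp_mk₀_eq {E : C} {O O' : D'} (u : O ⟶ H.obj E) (tr' : H'.obj (Φ.obj E) ⟶ O')
    {u' : O ⟶ H'.obj (Φ.obj E)} {tr : H.obj E ⟶ O'} (hu : u ≫ γ E = u') (htr : γ E ≫ tr' = tr) {n : ℕ}
    (x : Ext E E n) :
    (Ext.mk₀ u').comp (((x.mapExactFunctor Φ).mapExactFunctor H').comp (Ext.mk₀ tr') (add_zero n)) (zero_add n) =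
      (Ext.mk₀ u).comp ((x.mapExactFunctor H).comp (Ext.mk₀ tr) (add_zero n)) (zero_add n) := by
  subst hu htr
  rw [← Ext.mk₀_comp_mk₀, ← Ext.mk₀_comp_mk₀, Ext.comp_assoc_of_second_deg_zero,
    ← Ext.comp_assoc_of_third_deg_zero (x.mapExactFunctor H), mapExactFunctor_comp_mk₀_eq Φ H H' γ hγ x,
    Ext.comp_assoc_of_third_deg_zero]

include hγ in
/-- **Sandwich form with coefficients** (`x ∈ Extⁿ(E, Y)`, e.g. `Y = E ⊗ G` for the trace `Tr_G` with coefficients): if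
`u ≫ γ_E = u'` and `γ_Y ≫ tr' = tr` then `u' ≫ H'(Φ(x)) ≫ tr' = u ≫ H(x) ≫ tr` in `Extⁿ(O, O')`. [folklore] -/
theorem mk₀_comp_mapExactFunctor_comp_mk₀_eq' {E Y : C} {O O' : D'} (u : O ⟶ H.obj E) (tr' : H'.obj (Φ.obj Y) ⟶ O')
    {u' : O ⟶ H'.obj (Φ.obj E)} {tr : H.obj Y ⟶ O'} (hu : u ≫ γ E = u') (htr : γ Y ≫ tr' = tr) {n : ℕ}
    (x : Ext E Y n) :
    (Ext.mk₀ u').comp (((x.mapExactFunctor Φ).mapExactFunctor H').comp (Ext.mk₀ tr') (add_zero n)) (zero_add n) =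
      (Ext.mk₀ u).comp ((x.mapExactFunctor H).comp (Ext.mk₀ tr) (add_zero n)) (zero_add n) := by
  subst hu htr
  rw [← Ext.mk₀_comp_mk₀, ← Ext.mk₀_comp_mk₀, Ext.comp_assoc_of_second_deg_zero,
    ← Ext.comp_assoc_of_third_deg_zero (x.mapExactFunctor H), mapExactFunctor_comp_mk₀_eq Φ H H' γ hγ x,
    Ext.comp_assoc_of_third_deg_zero]

end ExtFunctoriality

/-! ### The trace on `Ext` is twist-invariant -/

section Trace

universe w u

open CocycleTwist Literature.AlgebraicGeometry.Modules Literature.AlgebraicGeometry.Motives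
  Literature.AlgebraicGeometry.HodgeTheory

variable {X : Scheme.{u}} [HasExt.{w} X.Modules] (c : UnitCocycle X) {E : X.Modules} (hE : IsFiniteLocallyFree E)

/-- **The trace on `Ext` is twist-invariant**: `Tr_{E ⊗ M}(x ⊗ 1_M) = Tr_E(x)` in `Extⁿ(𝒪_X, 𝒪_X)` for every
`x ∈ Extⁿ(E, E)`, `E` finite locally free, `M = lineBundle c` (`x ⊗ 1_M` = Mathlib's `Functor.mapExtAddHom` of the
twist functor). Proof: `Tr(x) = u_E ≫ 𝓗om(E, x) ≫ tr_E`; `𝓗om(E ⊗ M, x ⊗ 1) = (𝓗om(E⊗M, –) ∘ (-⊗M))(x)` is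
intertwined with `𝓗om(E, x)` by the comparison `γ = sheafHomTwist` (`mapExactFunctor_comp_mk₀_eq`), and `γ` preserves unit and
trace (`sheafHomUnit_comp_sheafHomTwist`, `sheafHomTwist_comp_trace`, file #16).
[cite: BuchweitzFlenner2003, §4 (trace map)] -/
theorem traceExt_twist (n : ℕ) (x : Ext.{w} E E n) :
    traceExt (isFiniteLocallyFree_twist c hE) n ((twistEquivalence X c).functor.mapExtAddHom E E n x) =
      traceExt hE n x := by
  haveI := preservesFiniteColimits_sheafHomFunctor E hE
  haveI := preservesFiniteColimits_sheafHomFunctor (twist c E) (isFiniteLocallyFree_twist c hE)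
  rw [Functor.mapExtAddHom_apply, traceExt_apply, traceExt_apply]
  exact mk₀_comp_mapExactFunctor_comp_mk₀_eq (twistEquivalence X c).functor (sheafHomFunctor E)
    (sheafHomFunctor (twist c E)) (fun F => sheafHomTwist c E F) (fun _ _ f => sheafHomMap_comp_sheafHomTwist c f)
    (sheafHomUnit E) (trace (isFiniteLocallyFree_twist c hE)) (sheafHomUnit_comp_sheafHomTwist c E)
    (sheafHomTwist_comp_trace c E hE) x

end Trace

/-! ### `σ_0` is twist-invariant; `0`-semiregularity transports unconditionally -/

section Sigma

universe w u

open CocycleTwist Literature.AlgebraicGeometry.Modules Literature.AlgebraicGeometry.Motives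
  Literature.AlgebraicGeometry.HodgeTheory

variable {S : Type u} [CommRing S] {X : Over (Spec (CommRingCat.of S))} [HasExt.{w} X.left.Modules]
  (c : UnitCocycle X.left) {E : X.left.Modules} (hE : IsFiniteLocallyFree E)

/-- **`σ_0 = Tr : Ext²(E, E) → H²(X, 𝒪_X)` is twist-invariant**: `σ_0^{E ⊗ M}(x ⊗ 1_M) = σ_0^{E}(x)`.
[cite: BuchweitzFlenner2003, §1 (σ_0) and Def. 4.1] -/
theorem sigmaZero_twist (x : Ext.{w} E E 2) :
    sigmaZero (isFiniteLocallyFree_twist c hE) ((twistEquivalence X.left c).functor.mapExtAddHom E E 2 x) =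
      sigmaZero hE x := by
  rw [sigmaZero_apply, sigmaZero_apply, traceExt_twist]

/-- Kernel form: `θ x ∈ ker σ_0^{E ⊗ M} ↔ x ∈ ker σ_0^{E}` (with `θ` bijective: the two kernels correspond, so the
`σ_0`-ranks of `E` and `E ⊗ M` agree). [cite: BuchweitzFlenner2003, §1 (σ_0)] -/
theorem sigmaZero_twist_eq_zero_iff (x : Ext.{w} E E 2) :
    sigmaZero (isFiniteLocallyFree_twist c hE) ((twistEquivalence X.left c).functor.mapExtAddHom E E 2 x) = 0 ↔
      sigmaZero hE x = 0 := by
  rw [sigmaZero_twist]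

/-- **The `q = 0` row of the Leibniz re-expansion `hσ`, DISCHARGED on real carriers** (for every cocycle `c`):
`σ_0^{E ⊗ M}(θ x) = σ_0^{E}(x)` for the real `sigmaHigher _ 0` of `SemiregularityHigherSigma` and the constructed
`θ = (twistEquivalence X c).functor.mapExtAddHom E E 2` of file #13 (`d_0 = id`, empty sum of lower terms).
[cite: BuchweitzFlenner2003, Def. 4.1; Atiyah1957, Prop. 10–12 (form degree 0: no Atiyah class enters)] -/
theorem sigmaHigher_zero_twist (x : Ext.{w} E E 2) :
    sigmaHigher (isFiniteLocallyFree_twist c hE) 0 ((twistEquivalence X.left c).functor.mapExtAddHom E E 2 x) =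
      sigmaHigher hE 0 x := by
  apply (hodgeCohomologyZeroAddEquiv X 2).injective
  rw [hodgeCohomologyZeroAddEquiv_sigmaHigher_zero, hodgeCohomologyZeroAddEquiv_sigmaHigher_zero, sigmaZero_twist]

/-- **`0`-semiregularity (injectivity of the Mukai–Artamkin trace `σ_0 : Ext²(E, E) → H²(X, 𝒪_X)`) of `E` iff of
`E ⊗ M`** — UNCONDITIONAL (no binder): `σ_0^{E⊗M} ∘ θ = σ_0^{E}` with `θ` bijective.
[cite: BuchweitzFlenner2003, §1 (k-semiregular)] -/
theorem isZeroSemiregular_iff_twist : IsZeroSemiregular hE ↔ IsZeroSemiregular (isFiniteLocallyFree_twist c hE) := by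
  have hθ := mapExtAddHom_twist_bijective c E E 2
  have hcomp : (sigmaZero (isFiniteLocallyFree_twist c hE)) ∘
      ((twistEquivalence X.left c).functor.mapExtAddHom E E 2) = sigmaZero hE :=
    funext fun x => sigmaZero_twist c hE x
  unfold IsZeroSemiregular
  rw [← hcomp]
  exact Function.Injective.of_comp_iff' _ hθ

/-- **`IsHigherSemiregular _ 0` of `E` iff of `E ⊗ M`** (the same statement on the carrier `H²(X, Ω⁰)` of
`SemiregularityHigherSigma`), unconditional. [cite: BuchweitzFlenner2003, §1 (k-semiregular)] -/
theorem isHigherSemiregular_zero_iff_twist :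
    IsHigherSemiregular hE 0 ↔ IsHigherSemiregular (isFiniteLocallyFree_twist c hE) 0 := by
  have hθ := mapExtAddHom_twist_bijective c E E 2
  have hcomp : (sigmaHigher (isFiniteLocallyFree_twist c hE) 0) ∘
      ((twistEquivalence X.left c).functor.mapExtAddHom E E 2) = sigmaHigher hE 0 :=
    funext fun x => sigmaHigher_zero_twist c hE x
  unfold IsHigherSemiregular
  rw [← hcomp]
  exact Function.Injective.of_comp_iff' _ hθ

/-- **`{0}`-semiregularity (`I = Iic 0`) of `E` iff of `E ⊗ M`, through file #13's `isISemiregular_iff_twist` with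
its binder `hσ` DISCHARGED** (`u = 0`; the only row asked for on `I = {0}` is `q = 0`, `sigmaHigher_zero_twist`).
[cite: BuchweitzFlenner2003, §5 (I-semiregular)] -/
theorem isISemiregular_Iic_zero_iff_twist :
    IsISemiregular.{w} hE (Set.Iic 0) ↔ IsISemiregular.{w} (isFiniteLocallyFree_twist c hE) (Set.Iic 0) :=
  isISemiregular_iff_twist c hE (fun _ _ => 0) (isLowerSet_Iic 0) fun q hq x => by
    obtain rfl : q = 0 := Nat.le_zero.mp (Set.mem_Iic.mp hq)
    rw [Finset.range_zero, Finset.sum_empty, add_zero]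
    exact sigmaHigher_zero_twist c hE x

end Sigma

/-! ### The binder `hσ` of file #13 is now needed only in form degrees `q ≥ 1` -/

section SigmaPos

universe w u

open CocycleTwist Literature.AlgebraicGeometry.Modules Literature.AlgebraicGeometry.Motives
  Literature.AlgebraicGeometry.HodgeTheory

variable {S : Type u} [CommRing S] {X : Over (Spec (CommRingCat.of S))} [HasExt.{w} X.left.Modules]
  (c : UnitCocycle X.left) {E : X.left.Modules} (hE : IsFiniteLocallyFree E)

/-- **`I`-semiregularity of `E` iff of `E ⊗ M`, with the Leibniz re-expansion assumed ONLY in form degrees `q ≥ 1`**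
(`q ∈ I`, `0 < q`): the row `q = 0` is `sigmaHigher_zero_twist`. For `I = {0}` nothing is assumed
(`isISemiregular_Iic_zero_iff_twist`); for `I = {0, 1}` exactly one identity is (next theorem; the row `q = 1` itself —
Atiyah's `At(E ⊗ M) = At(E) ⊗ 1 + 1 ⊗ At(M)` on these carriers — is seat gs-g4's: `UntwistCocycleTwistDualHom.lean` ff.).
[cite: BuchweitzFlenner2003, §5 (I-semiregular); Atiyah1957, Prop. 10–12] -/
theorem isISemiregular_iff_twist_of_pos
    (u : ∀ q j, hodgeCohomology X j (j + 2) →+ hodgeCohomology X q (q + 2))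
    {I : Set ℕ} (hI : IsLowerSet I)
    (hσ : ∀ q ∈ I, 0 < q → ∀ x : Ext.{w} E E 2,
      sigmaHigher (isFiniteLocallyFree_twist c hE) q ((twistEquivalence X.left c).functor.mapExtAddHom E E 2 x) =
        sigmaHigher hE q x + ∑ j ∈ Finset.range q, u q j (sigmaHigher hE j x)) :
    IsISemiregular.{w} hE I ↔ IsISemiregular.{w} (isFiniteLocallyFree_twist c hE) I :=
  isISemiregular_iff_twist c hE u hI fun q hq x => by
    rcases Nat.eq_zero_or_pos q with rfl | hpos
    · rw [Finset.range_zero, Finset.sum_empty, add_zero]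
      exact sigmaHigher_zero_twist c hE x
    · exact hσ q hq hpos x

/-- **`{0, 1}`-semiregularity (`I = Iic 1 = {q < 2}`, the p-adic shape at `p = 2`) of `E` iff of `E ⊗ M`, GIVEN ONLY the
degree-one identity `σ_1^{E ⊗ M}(θ x) = σ_1^{E}(x) + u(σ_0^{E}(x))`** for some additive `u : H²(X, Ω⁰) → H³(X, Ω¹)`
(intended: `u` = cup product with `c₁(M) = [dlog g_{xy}] ∈ H¹(X, Ω¹)`, from Atiyah 1957 Prop. 10,
`At(E ⊗ M) = At(E) ⊗ 1 + 1 ⊗ At(M)` — the one row of the Leibniz rule that remains a binder for this `I`). [cite: BuchweitzFlenner2003, §5 (I-semiregular); Atiyah1957, Prop. 10–12] -/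
theorem isISemiregular_Iic_one_iff_twist_of_sigmaOne (u : hodgeCohomology X 0 2 →+ hodgeCohomology X 1 3)
    (hσ₁ : ∀ x : Ext.{w} E E 2,
      sigmaHigher (isFiniteLocallyFree_twist c hE) 1 ((twistEquivalence X.left c).functor.mapExtAddHom E E 2 x) =
        sigmaHigher hE 1 x + u (sigmaHigher hE 0 x)) :
    IsISemiregular.{w} hE (Set.Iic 1) ↔ IsISemiregular.{w} (isFiniteLocallyFree_twist c hE) (Set.Iic 1) := by
  classical
  refine isISemiregular_iff_twist_of_pos c hE
    (fun q j => if h : q = 1 ∧ j = 0 then h.2 ▸ h.1 ▸ u else 0) (isLowerSet_Iic 1) fun q hq hpos x => ?_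
  obtain rfl : q = 1 := le_antisymm (Set.mem_Iic.mp hq) hpos
  rw [Finset.sum_range_one, dif_pos ⟨rfl, rfl⟩]
  exact hσ₁ x

end SigmaPos

end Summit.Ventures.HSemireg

end
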